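import Summits.Ventures.YMGap.Thresholds.LatticeBakryEmeryFrame
import HarnessLib

/-!
# Venture YMGap — multi-link Bakry–Émery calculus, Part C2:
# Bochner's formula and the curvature bound `Γ₂ ≥ (N/2 - Λ) Γ` on `SU(N)^E`

HONEST FRAMING: venture file (cell `pub-ymgap`, track (a), seat p2). Calculus towards a kernel
proof of the multi-link Bakry–Émery Poincaré inequality for lattice `SU(N)` Yang–Mills; no measure
theory yet. The proofs are those of the one-link tree file `SUNBakryEmeryPoincare.lean` (Part C,
"The Bochner formula" and "The curvature-dimension inequality") in the block frame of
`LatticeBakryEmeryFrame.lean`; what is new is only bookkeeping: the Ricci term splits over the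
links (`Ric = N/2` on each factor `SU(N)`, Shen–Zhu–Zhu (4.8)) and the Hessian of the potential is
taken as a HYPOTHESIS `|D_V D_V S(Q)| ≤ Λ ‖V‖²` for `V ∈ 𝔰𝔲(N)^E` (for the Wilson action it is the
venture's kernel theorem "Hessian ≤ 4d", supplied downstream).

Main results: `Gam2_eq` (Bochner: `Γ₂(u) = ∑_{ab} (D_aD_bu)² - ∑_{ab} D_au D_bu D_aD_bS`),
`sum_sum_sq_comm_algD` (`∑_{ab} ([D_a,D_b]u)² = 2N Γ(u,u)`), `sum_sum_hess_eq`
(`∑_{ab} D_au D_bu D_aD_bS = D_V D_V S`, `V = ∇u ∈ 𝔰𝔲(N)^E`, `‖V‖² = Γ(u,u)`), and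
`Gam2_ge_of_hess` (`Γ₂(u)(Q) ≥ (N/2 - Λ) Γ(u,u)(Q)`).

## References

* D. Bakry, M. Émery, *Diffusions hypercontractives*, LNM 1123 (1985) 177–206.
* H. Shen, R. Zhu, X. Zhu, CMP 400 (2023) 805–851 = arXiv:2204.12737, Lemma 4.1, (4.2)–(4.8).
* Tree files `SUNBakryEmeryFrame.lean`, `SUNBakryEmeryPoincare.lean` (Part C).
-/

noncomputable section

open scoped Matrix ComplexConjugate BigOperators Matrix.Norms.Frobenius ContDiff Topology
open Matrix Complex Finset
open Literature.MathematicalPhysics.QuantumFieldTheory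
open Literature.MathematicalPhysics.QuantumFieldTheory.SUNBakryEmery
  (FrameIdx frame frame_conjTranspose frame_trace frameGrad frameGrad_conjTranspose frameGrad_trace
   apply_eq_neg_re_trace_mul_frameGrad frobNorm_frameGrad_sq sum_sq_re_trace_frame_mul
   sum_frobNorm_sq_comm_frame conjTranspose_comm_of_skew trace_comm)

namespace Summit.Ventures.YMGap

namespace LatticeBakryEmery

universe u

variable {ι : Type u} [Fintype ι] [DecidableEq ι] {N : ℕ}

section Calculus

/-! ### The Bochner formula -/

/-- The **iterated carré du champ** `Γ₂(u) = ½ L_S Γ(u,u) - Γ(u, L_S u)` (Bakry–Émery). -/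
def Gam2 (S u : Cfg ι N → ℝ) (Q : Cfg ι N) : ℝ :=
  (1 / 2) * genL S (Gam u u) Q - Gam u (genL S u) Q

/-- `D_B Γ(u,u) = 2 ∑_a D_a u · D_B D_a u`. -/
theorem algD_Gam_self {u : Cfg ι N → ℝ} (hu : ContDiff ℝ ∞ u) (B : Cfg ι N) (Q : Cfg ι N) :
    algD B (Gam u u) Q = ∑ a : BIdx ι N, 2 * algD (bframe a) u Q * algD B (algD (bframe a) u) Q := by
  have : Gam u u = fun Q => ∑ a : BIdx ι N, algD (bframe a) u Q * algD (bframe a) u Q := rfl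
  rw [this, algD_sum univ (F := fun a Q => algD (bframe a) u Q * algD (bframe a) u Q)
    (fun a _ => (contDiff_algD hu _).mul (contDiff_algD hu _))]
  refine sum_congr rfl fun a _ => ?_
  rw [algD_fun_mul (contDiff_algD hu _) (contDiff_algD hu _)]
  ring

/-- `Δ Γ(u,u) = 2 ∑_{ab} (D_b D_a u)² + 2 ∑_a D_a u · D_a Δ u`. -/
theorem Lap_Gam_self (hN : N ≠ 0) {u : Cfg ι N → ℝ} (hu : ContDiff ℝ ∞ u) (Q : Cfg ι N) :
    Lap (Gam u u) Q = 2 * ∑ b : BIdx ι N, ∑ a : BIdx ι N, algD (bframe b) (algD (bframe a) u) Q ^ 2 +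
      2 * ∑ a : BIdx ι N, algD (bframe a) u Q * algD (bframe a) (Lap u) Q := by
  have h1 : ∀ b : BIdx ι N, algD (bframe b) (algD (bframe b) (Gam u u)) Q =
      ∑ a, 2 * (algD (bframe b) (algD (bframe a) u) Q ^ 2 +
        algD (bframe a) u Q * algD (bframe b) (algD (bframe b) (algD (bframe a) u)) Q) := by
    intro b
    have hfun : algD (bframe b) (Gam u u) =
        fun Q => ∑ a, 2 * (algD (bframe a) u Q * algD (bframe b) (algD (bframe a) u) Q) := by
      funext Q
      rw [algD_Gam_self hu]
      simp only [mul_assoc]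
    rw [hfun, algD_sum univ (F := fun a Q => 2 * (algD (bframe a) u Q * algD (bframe b) (algD (bframe a) u) Q))
      (fun a _ => contDiff_const.mul ((contDiff_algD hu _).mul (contDiff_algD (contDiff_algD hu _) _)))]
    refine sum_congr rfl fun a _ => ?_
    rw [algD_const_mul ((contDiff_algD hu _).mul (contDiff_algD (contDiff_algD hu _) _)),
      algD_fun_mul (contDiff_algD hu _) (contDiff_algD (contDiff_algD hu _) _)]
    ring
  simp only [Lap] at h1 ⊢
  simp_rw [h1, ← mul_sum, sum_add_distrib, mul_add]
  congr 1
  rw [sum_comm]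
  simp_rw [← mul_sum, sum_algD_algD_algD_eq_algD_Lap hN hu]

/-- `Γ(u, L_S u) = ∑_a D_a u D_a Δu + ∑_{ab} D_a u (D_a D_b S · D_b u + D_b S · D_a D_b u)`. -/
theorem Gam_genL {S u : Cfg ι N → ℝ} (hS : ContDiff ℝ ∞ S) (hu : ContDiff ℝ ∞ u) (Q : Cfg ι N) :
    Gam u (genL S u) Q = ∑ a : BIdx ι N, algD (bframe a) u Q * algD (bframe a) (Lap u) Q +
      ∑ a : BIdx ι N, ∑ b : BIdx ι N, algD (bframe a) u Q *
        (algD (bframe a) (algD (bframe b) S) Q * algD (bframe b) u Q +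
          algD (bframe b) S Q * algD (bframe a) (algD (bframe b) u) Q) := by
  have hgen : genL S u = Lap u + Gam S u := by funext Q; rfl
  have hGam : ∀ a : BIdx ι N, algD (bframe a) (Gam S u) Q =
      ∑ b, (algD (bframe a) (algD (bframe b) S) Q * algD (bframe b) u Q +
        algD (bframe b) S Q * algD (bframe a) (algD (bframe b) u) Q) := by
    intro a
    have hfun : Gam S u = fun Q => ∑ b : BIdx ι N, algD (bframe b) S Q * algD (bframe b) u Q := rfl
    rw [hfun, algD_sum univ (F := fun b Q => algD (bframe b) S Q * algD (bframe b) u Q)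
      (fun b _ => (contDiff_algD hS _).mul (contDiff_algD hu _))]
    refine sum_congr rfl fun b _ => ?_
    rw [algD_fun_mul (contDiff_algD hS _) (contDiff_algD hu _)]
    ring
  rw [Gam, ← sum_add_distrib]
  refine sum_congr rfl fun a _ => ?_
  rw [hgen, algD_add (contDiff_Lap hu) (contDiff_Gam hS hu), Pi.add_apply, hGam, mul_add, mul_sum]

/-- **Bochner's formula on `SU(N)^E` in the block frame** (Bakry–Émery; Shen–Zhu–Zhu (4.2)–(4.3)):
`Γ₂(u) = ∑_{ab} (D_a D_b u)² - ∑_{ab} D_a u D_b u · D_a D_b S` — the Ricci term is hidden in the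
non-commutativity of the `D_a`. -/
theorem Gam2_eq (hN : N ≠ 0) {S u : Cfg ι N → ℝ} (hS : ContDiff ℝ ∞ S) (hu : ContDiff ℝ ∞ u) (Q : Cfg ι N) :
    Gam2 S u Q = ∑ a : BIdx ι N, ∑ b : BIdx ι N, algD (bframe a) (algD (bframe b) u) Q ^ 2 -
      ∑ a : BIdx ι N, ∑ b : BIdx ι N,
        algD (bframe a) u Q * algD (bframe b) u Q * algD (bframe a) (algD (bframe b) S) Q := by
  -- the commutator term vanishes (antisymmetry of the structure constants)
  have hcomm : ∑ a : BIdx ι N, ∑ b : BIdx ι N, algD (bframe b) S Q * algD (bframe a) u Q *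
      (algD (bframe b) (algD (bframe a) u) Q - algD (bframe a) (algD (bframe b) u) Q) = 0 := by
    have h1 : ∀ a b : BIdx ι N, algD (bframe b) (algD (bframe a) u) Q - algD (bframe a) (algD (bframe b) u) Q =
        ∑ c, bstrC b a c * algD (bframe c) u Q := fun a b => algD_algD_sub_eq_sum_bstrC hN hu b a Q
    simp_rw [h1, mul_sum]
    rw [sum_comm]
    refine sum_eq_zero fun b _ => ?_
    have : ∑ a, ∑ c, algD (bframe b) S Q * algD (bframe a) u Q * (bstrC b a c * algD (bframe c) u Q) =
        algD (bframe b) S Q * ∑ a, ∑ c, bstrC b a c * (algD (bframe a) u Q * algD (bframe c) u Q) := by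
      rw [mul_sum]
      refine sum_congr rfl fun a _ => ?_
      rw [mul_sum]
      exact sum_congr rfl fun c _ => by ring
    rw [this, sum_sum_eq_zero_of_antisymm (fun a c => bstrC_swap23 b a c) (fun a c => mul_comm _ _), mul_zero]
  have eC : Gam S (Gam u u) Q =
      2 * ∑ b : BIdx ι N, ∑ a : BIdx ι N,
        algD (bframe b) S Q * algD (bframe a) u Q * algD (bframe b) (algD (bframe a) u) Q := by
    show ∑ b, algD (bframe b) S Q * algD (bframe b) (Gam u u) Q = _
    simp_rw [algD_Gam_self hu, mul_sum]
    refine sum_congr rfl fun b _ => sum_congr rfl fun a _ => ?_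
    ring
  have eSwap : ∑ b : BIdx ι N, ∑ a : BIdx ι N,
      algD (bframe b) S Q * algD (bframe a) u Q * algD (bframe b) (algD (bframe a) u) Q =
      ∑ a : BIdx ι N, ∑ b : BIdx ι N,
        algD (bframe b) S Q * algD (bframe a) u Q * algD (bframe a) (algD (bframe b) u) Q := by
    rw [sum_comm]
    have h0 : ∑ a : BIdx ι N, ∑ b : BIdx ι N,
        algD (bframe b) S Q * algD (bframe a) u Q * algD (bframe b) (algD (bframe a) u) Q -
        ∑ a : BIdx ι N, ∑ b : BIdx ι N,
          algD (bframe b) S Q * algD (bframe a) u Q * algD (bframe a) (algD (bframe b) u) Q = 0 := by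
      rw [← sum_sub_distrib]
      simp_rw [← sum_sub_distrib, ← mul_sub]
      exact hcomm
    linarith
  have eB : ∑ a : BIdx ι N, ∑ b : BIdx ι N, algD (bframe a) u Q *
        (algD (bframe a) (algD (bframe b) S) Q * algD (bframe b) u Q +
          algD (bframe b) S Q * algD (bframe a) (algD (bframe b) u) Q) =
      ∑ a : BIdx ι N, ∑ b : BIdx ι N,
        algD (bframe a) u Q * algD (bframe b) u Q * algD (bframe a) (algD (bframe b) S) Q +
        ∑ a : BIdx ι N, ∑ b : BIdx ι N,
          algD (bframe b) S Q * algD (bframe a) u Q * algD (bframe a) (algD (bframe b) u) Q := by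
    rw [← sum_add_distrib]
    refine sum_congr rfl fun a _ => ?_
    rw [← sum_add_distrib]
    exact sum_congr rfl fun b _ => by ring
  rw [Gam2, show genL S (Gam u u) Q = Lap (Gam u u) Q + Gam S (Gam u u) Q from rfl, Lap_Gam_self hN hu, eC,
    eSwap, Gam_genL hS hu, eB]
  ring

/-! ### The Ricci term: `Ric = N/2` link by link -/

omit [DecidableEq ι] in
/-- `∑_{ab} (m_{ab} - m_{ba})² ≤ 4 ∑_{ab} m_{ab}²`. -/
theorem sum_sum_sq_sub_swap_le (m : BIdx ι N → BIdx ι N → ℝ) :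
    ∑ a, ∑ b, (m a b - m b a) ^ 2 ≤ 4 * ∑ a, ∑ b, m a b ^ 2 := by
  have h : ∀ a b, (m a b - m b a) ^ 2 ≤ 2 * m a b ^ 2 + 2 * m b a ^ 2 := fun a b => by
    nlinarith [sq_nonneg (m a b + m b a)]
  calc ∑ a, ∑ b, (m a b - m b a) ^ 2 ≤ ∑ a, ∑ b, (2 * m a b ^ 2 + 2 * m b a ^ 2) :=
        sum_le_sum fun a _ => sum_le_sum fun b _ => h a b
    _ = 2 * ∑ a, ∑ b, m a b ^ 2 + 2 * ∑ a, ∑ b, m b a ^ 2 := by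
        simp only [sum_add_distrib, mul_sum]
    _ = 4 * ∑ a, ∑ b, m a b ^ 2 := by
        rw [sum_comm (f := fun a b => m b a ^ 2)]
        ring

/-- The derivative functional of `u` at `Q` restricted to the link `e`: `A ↦ D_{single_e A} u(Q)`. -/
def linkFun (u : Cfg ι N → ℝ) (Q : Cfg ι N) (e : ι) : Matrix (Fin N) (Fin N) ℂ →ₗ[ℝ] ℝ :=
  (dirFun u Q).comp (LinearMap.single ℝ (fun _ : ι => Matrix (Fin N) (Fin N) ℂ) e)

/-- `linkFun u Q e A = D_{single_e A} u (Q)`. -/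
@[simp] theorem linkFun_apply (u : Cfg ι N → ℝ) (Q : Cfg ι N) (e : ι) (A : Matrix (Fin N) (Fin N) ℂ) :
    linkFun u Q e A = algD (lk e A) u Q := rfl

/-- **The Killing form of `𝔰𝔲(N)` against a linear functional**: for a real linear functional `λ`
on `M_N(ℂ)`, `∑_{αβ} λ([Y_α, Y_β])² = 2N ∑_α λ(Y_α)²` (`Ric_{SU(N)} = N/2` for the Hilbert–Schmidt
metric, Shen–Zhu–Zhu (4.4)/(4.8)). -/
theorem sum_sum_sq_apply_comm_frame (hN : N ≠ 0) (lam : Matrix (Fin N) (Fin N) ℂ →ₗ[ℝ] ℝ) :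
    ∑ α : FrameIdx N, ∑ β : FrameIdx N, lam (frame α * frame β - frame β * frame α) ^ 2 =
      2 * N * ∑ α : FrameIdx N, lam (frame α) ^ 2 := by
  set Z := frameGrad lam with hZdef
  have hZ : Zᴴ = -Z := frameGrad_conjTranspose _
  have hZ0 : Z.trace = 0 := frameGrad_trace hN _
  have hW : ∀ α β : FrameIdx N, lam (frame α * frame β - frame β * frame α) =
      -(frame β * (Z * frame α - frame α * Z)).trace.re := by
    intro α β
    rw [apply_eq_neg_re_trace_mul_frameGrad hN lam
      (conjTranspose_comm_of_skew (frame_conjTranspose α) (frame_conjTranspose β)) (trace_comm _ _), ← hZdef]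
    congr 2
    rw [Matrix.sub_mul, Matrix.mul_sub, trace_sub, trace_sub]
    have e1 : (frame α * frame β * Z).trace = (frame β * (Z * frame α)).trace := by
      rw [Matrix.mul_assoc, trace_mul_comm, Matrix.mul_assoc]
    have e2 : (frame β * frame α * Z).trace = (frame β * (frame α * Z)).trace := by
      rw [Matrix.mul_assoc]
    rw [e1, e2]
  have hWskew : ∀ α : FrameIdx N, (Z * frame α - frame α * Z)ᴴ = -(Z * frame α - frame α * Z) := fun α =>
    conjTranspose_comm_of_skew hZ (frame_conjTranspose α)
  simp_rw [hW, neg_sq, sum_sq_re_trace_frame_mul hN (hWskew _) (trace_comm _ _),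
    sum_frobNorm_sq_comm_frame hN hZ hZ0, hZdef, frobNorm_frameGrad_sq hN]

/-- `Γ(u,u)(Q) = ∑_e ∑_α λ_e(Y_α)²` with `λ_e = linkFun u Q e`. -/
theorem Gam_self_eq_sum_linkFun (u : Cfg ι N → ℝ) (Q : Cfg ι N) :
    Gam u u Q = ∑ e : ι, ∑ α : FrameIdx N, linkFun u Q e (frame α) ^ 2 := by
  rw [Gam_self_eq_sum_sq, Fintype.sum_prod_type]
  rfl

/-- **The Ricci term**: `∑_{ab} ([D_a, D_b] u)² = 2N Γ(u,u)` on `(E → M_N(ℂ))` — cross-link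
commutators vanish, and each link contributes the Killing form of `𝔰𝔲(N)` (`Ric = N/2` per factor,
Shen–Zhu–Zhu (4.8)). -/
theorem sum_sum_sq_comm_algD (hN : N ≠ 0) {u : Cfg ι N → ℝ} (hu : ContDiff ℝ ∞ u) (Q : Cfg ι N) :
    ∑ a : BIdx ι N, ∑ b : BIdx ι N,
        (algD (bframe a) (algD (bframe b) u) Q - algD (bframe b) (algD (bframe a) u) Q) ^ 2 =
      2 * N * Gam u u Q := by
  have hW : ∀ a b : BIdx ι N, algD (bframe a) (algD (bframe b) u) Q - algD (bframe b) (algD (bframe a) u) Q =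
      if a.1 = b.1 then linkFun u Q a.1 (frame a.2 * frame b.2 - frame b.2 * frame a.2) else 0 := by
    intro a b
    have h := congrFun (algD_comm hu (bframe a) (bframe b)) Q
    rw [Pi.sub_apply] at h
    rw [h, bframe_comm]
    split_ifs with hab
    · rfl
    · simp [algD]
  simp_rw [hW]
  rw [Gam_self_eq_sum_linkFun, mul_sum, Fintype.sum_prod_type]
  refine sum_congr rfl fun e _ => ?_
  have hin : ∀ α : FrameIdx N, ∑ x : BIdx ι N, (if ((e, α) : BIdx ι N).1 = x.1 then
      linkFun u Q ((e, α) : BIdx ι N).1 (frame ((e, α) : BIdx ι N).2 * frame x.2 - frame x.2 * frame ((e, α) : BIdx ι N).2)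
      else 0) ^ 2 = ∑ β : FrameIdx N, linkFun u Q e (frame α * frame β - frame β * frame α) ^ 2 := by
    intro α
    rw [Fintype.sum_prod_type, Finset.sum_eq_single e]
    · simp
    · intro e' _ he'
      exact sum_eq_zero fun β _ => by simp [Ne.symm he']
    · intro h; exact absurd (mem_univ _) h
  rw [sum_congr rfl fun α _ => hin α]
  exact sum_sum_sq_apply_comm_frame hN _

/-! ### The Hessian term as a second derivative along `∇u` -/

/-- The **gradient** `∇u(Q) = ∑_a D_a u(Q) Y_a ∈ 𝔰𝔲(N)^E`; its `e`-component is the one-link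
frame gradient of `λ_e`. -/
def grad (u : Cfg ι N → ℝ) (Q : Cfg ι N) : Cfg ι N := ∑ a : BIdx ι N, algD (bframe a) u Q • bframe a

/-- Components of the gradient: `(∇u)_e = Z_{λ_e}`. -/
theorem grad_apply (u : Cfg ι N → ℝ) (Q : Cfg ι N) (e : ι) : grad u Q e = frameGrad (linkFun u Q e) := by
  rw [grad, Fintype.sum_prod_type, Finset.sum_apply, Finset.sum_eq_single e]
  · rw [frameGrad, Finset.sum_apply]
    refine sum_congr rfl fun α _ => ?_
    simp [bframe, lk, linkFun_apply]
  · intro e' _ he'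
    rw [Finset.sum_apply]
    exact sum_eq_zero fun α _ => by simp [bframe, lk, he']
  · intro h; exact absurd (mem_univ _) h

/-- The gradient is skew-Hermitian in every link. -/
theorem grad_conjTranspose (u : Cfg ι N → ℝ) (Q : Cfg ι N) (e : ι) : (grad u Q e)ᴴ = -grad u Q e := by
  rw [grad_apply]; exact frameGrad_conjTranspose _

/-- The gradient is traceless in every link. -/
theorem grad_trace (hN : N ≠ 0) (u : Cfg ι N → ℝ) (Q : Cfg ι N) (e : ι) : (grad u Q e).trace = 0 := by
  rw [grad_apply]; exact frameGrad_trace hN _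

/-- **`‖∇u‖² = Γ(u,u)`**: `∑_e ‖(∇u)_e‖_F² = Γ(u,u)(Q)`. -/
theorem sum_frobNorm_grad_sq (hN : N ≠ 0) (u : Cfg ι N → ℝ) (Q : Cfg ι N) :
    ∑ e, frobNorm (grad u Q e) ^ 2 = Gam u u Q := by
  rw [Gam_self_eq_sum_linkFun]
  exact sum_congr rfl fun e _ => by rw [grad_apply, frobNorm_frameGrad_sq hN]

/-- **The Hessian term is a second derivative**: `∑_{ab} D_au D_bu D_aD_bS (Q) = (D_V D_V S)(Q)` with
the CONSTANT direction `V = ∇u(Q)` (bilinearity of `(A, B) ↦ D_A D_B S(Q)`). -/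
theorem sum_sum_hess_eq {S : Cfg ι N → ℝ} (hS : ContDiff ℝ ∞ S) (u : Cfg ι N → ℝ) (Q : Cfg ι N) :
    ∑ a : BIdx ι N, ∑ b : BIdx ι N,
        algD (bframe a) u Q * algD (bframe b) u Q * algD (bframe a) (algD (bframe b) S) Q =
      algD (grad u Q) (algD (grad u Q) S) Q := by
  set m : BIdx ι N → ℝ := fun a => algD (bframe a) u Q with hm
  have hV : grad u Q = ∑ b, m b • bframe b := rfl
  -- inner derivative: `D_V S = ∑_b m_b D_b S` as functions
  have hinner : algD (grad u Q) S = fun P => ∑ b, m b * algD (bframe b) S P := by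
    funext P; rw [hV]; exact algD_sum_smul_dir _ _ _ S P
  rw [hinner, algD_sum univ (F := fun b P => m b * algD (bframe b) S P)
    (fun b _ => contDiff_const.mul (contDiff_algD hS _))]
  simp only
  rw [sum_comm]
  refine sum_congr rfl fun b _ => ?_
  rw [algD_const_mul (contDiff_algD hS _), eq_comm]
  show m b * algD (grad u Q) (algD (bframe b) S) Q = _
  rw [hV, algD_sum_smul_dir, mul_sum]
  exact sum_congr rfl fun a _ => by simp only [hm]; ring

/-- **Bakry–Émery curvature bound on `SU(N)^E`** (Shen–Zhu–Zhu (4.7)–(4.8) with the Hessian constant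
as a hypothesis): if `|D_V D_V S(Q)| ≤ Λ ∑_e ‖V_e‖_F²` for every `V ∈ 𝔰𝔲(N)^E`, then
`Γ₂(u)(Q) ≥ (N/2 - Λ) Γ(u,u)(Q)`. -/
theorem Gam2_ge_of_hess (hN : N ≠ 0) {S u : Cfg ι N → ℝ} (hS : ContDiff ℝ ∞ S) (hu : ContDiff ℝ ∞ u)
    {Λ : ℝ} (Q : Cfg ι N)
    (hHess : ∀ V : Cfg ι N, (∀ e, (V e)ᴴ = -V e) → (∀ e, (V e).trace = 0) →
      |algD V (algD V S) Q| ≤ Λ * ∑ e, frobNorm (V e) ^ 2) :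
    ((N : ℝ) / 2 - Λ) * Gam u u Q ≤ Gam2 S u Q := by
  rw [Gam2_eq hN hS hu, sum_sum_hess_eq hS]
  have hRic : (N : ℝ) / 2 * Gam u u Q ≤ ∑ a : BIdx ι N, ∑ b : BIdx ι N, algD (bframe a) (algD (bframe b) u) Q ^ 2 := by
    have h1 := sum_sum_sq_sub_swap_le (fun a b : BIdx ι N => algD (bframe a) (algD (bframe b) u) Q)
    rw [sum_sum_sq_comm_algD hN hu Q] at h1
    linarith
  have hH := hHess (grad u Q) (grad_conjTranspose u Q) (grad_trace hN u Q)
  rw [sum_frobNorm_grad_sq hN] at hH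
  have hH' := (abs_le.1 hH).2
  nlinarith [hRic, hH', Gam_self_nonneg u Q]

end Calculus

end LatticeBakryEmery

end Summit.Ventures.YMGap
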